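import Summits.FinalStateConjecture.FinalStateConjecture.Theorems.EIHFluxBalanceInertialRecessionStubCoerMomQuantRows
import Summits.FinalStateConjecture.FinalStateConjecture.Theorems.EIHFluxBalanceInertialRecessionStubCoerMomQuantLimit

/-!
# Route EIHFluxBalance — `InertialRecession` (E′), line `SketchCleanExcision`, skeleton r13,
# stub `stub_coerMomQuant` (Bs): normalisation of a failing motion and vanishing of limit rows

Helper file for the crux `stmt-FinalStateConjecture-17403`
(`Summit.FinalStateConjecture.FinalStateConjecture.Theses.EIHFluxBalance.InertialRecession`, E′),
registered stub `stub_coerMomQuant` (Bs) of skeleton r13. The two reusable steps of the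
compactness argument of (Bs):

* `coerMomQ_normalise` — if the momentum rows of the modulated model `G + x⁰Var_{(A,d)}` are
  `< ε · red(A,d)` on a shell, then, after removing the stabiliser part of `(A, d)` (rows and
  reduced size unchanged) and rescaling (rows homogeneous, from ML(i)), there is a normalised
  motion `p ∈ Y`, `‖p‖ = 1`, whose rows are `< ε (1 + |a| + ‖spatial‖)` on the shell;
* `coerMomQ_limit_row_eq_zero` — along a convergent sequence of frames, motions and backgrounds
  (`coerMomQ_tendsto_row`), rows that are eventually `≤ εₙ → 0` have a vanishing limit row;
* `coerMomQ_poincareInv_zero_eq`, `coerMomQ_boostedKerrBilin_eq_frame` — bookkeeping between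
  the painted vocabulary (`poincareInv L 0`, `boostedKerrBilin L 0 M a`) and the frame operator
  `S = Λ⁻¹`.

Elementary; no definitions, no named facts, no `sorry`.
-/

set_option linter.dupNamespace false
set_option maxSynthPendingDepth 6
set_option synthInstance.maxHeartbeats 200000

noncomputable section

open Set Function Filter Literature.Geometry.Lorentzian Literature.Geometry.Lorentzian.MetricCoord
open scoped Topology ContDiff

namespace Summit.FinalStateConjecture.FinalStateConjecture.Theorems.SublinearIsFree.Slaving

/-! ### Painted vocabulary versus the frame operator -/

/-- `Λ⁻¹(· − 0) = Λ⁻¹` as the frame operator (an equality of maps `E4 → E4`). [folklore] -/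
theorem coerMomQ_poincareInv_zero_eq (L : lorentzGroup) :
    poincareInv L 0 = ⇑((L : E4 ≃L[ℝ] E4).symm : E4 →L[ℝ] E4) := by
  funext z
  simp [poincareInv]

/-- The painted summand with centre `0` through the frame operator `S = Λ⁻¹`:
`boostedKerrBilin Λ 0 M a = (z ↦ g(Sz)(S·, S·))`. [cite: KerrSchild1965, §3] -/
theorem coerMomQ_boostedKerrBilin_eq_frame (L : lorentzGroup) (M a : ℝ) :
    boostedKerrBilin L 0 M a = fun z : E4 ↦ (Kerr.bilin M a (((L : E4 ≃L[ℝ] E4).symm : E4 →L[ℝ] E4) z)).bilinearComp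
      ((L : E4 ≃L[ℝ] E4).symm : E4 →L[ℝ] E4) ((L : E4 ≃L[ℝ] E4).symm : E4 →L[ℝ] E4) := by
  funext z
  ext v w
  rw [boostedKerrBilin_apply, ContinuousLinearMap.bilinearComp_apply, coerMomQ_poincareInv_zero_eq]
  rfl

/-- `dx⁰(e_{j+1}) = 0` for the spatial coordinate vectors. [folklore] -/
theorem coerMomQ_dx_zero_basisVector_succ (j : Fin 3) : E4.dx 0 (E4.basisVector j.succ) = 0 := by
  simp [Fin.succ_ne_zero]

/-! ### Normalisation of a failing motion -/

set_option maxHeartbeats 1600000 in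
/-- **Normalisation of a failing motion.** Suppose the momentum rows of `G + x⁰Var_{(A,d)}` are
`< ε · red(A, d)` at every offset of a nonempty shell on which `G` is defined and the painted radius
is positive. Remove from `(A, d)` its stabiliser part `(K, k)` (`Y` a complement of the stabiliser in
the skew motions): the rows (`coerMomQ_ricAt_add_stab`) and the reduced size are unchanged, so the
normalised part is nonzero; rescale it to norm one (rows are homogeneous, `coerMomQ_row_smul`, from
ML(i)). The resulting `p ∈ Y`, `‖p‖ = 1` has rows `< ε (1 + |a| + ‖spatial‖)` on the shell.
[folklore] -/
theorem coerMomQ_normalise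
    (hML : ∀ {G G₁ G₂ G₃ : E4 → E4 →L[ℝ] E4 →L[ℝ] ℝ} {V : Set E4} {x : E4} {n : E4 →L[ℝ] ℝ} {A₁ A₂ : E4 →L[ℝ] E4 →L[ℝ] ℝ} {P₁ P₂ : E4 →L[ℝ] E4 →L[ℝ] E4 →L[ℝ] ℝ} {W₁ W₂ W₃ : E4 →L[ℝ] E4 →L[ℝ] ℝ} (c₁ c₂ : ℝ), MetricCoord.IsMetricOn G V → MetricCoord.IsMetricOn G₁ V → MetricCoord.IsMetricOn G₂ V → MetricCoord.IsMetricOn G₃ V → x ∈ V → G₁ x = G x → G₂ x = G x → G₃ x = G x → fderiv ℝ G₁ x = fderiv ℝ G x + n.smulRight A₁ → fderiv ℝ G₂ x = fderiv ℝ G x + n.smulRight A₂ → fderiv ℝ G₃ x = fderiv ℝ G x + n.smulRight (c₁ • A₁ + c₂ • A₂) → (∀ v, fderiv ℝ (fderiv ℝ G₁) x v = fderiv ℝ (fderiv ℝ G) x v + (n v • P₁ + n.smulRight (P₁ v) + n v • n.smulRight W₁)) → (∀ v, fderiv ℝ (fderiv ℝ G₂) x v = fderiv ℝ (fderiv ℝ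 G) x v + (n v • P₂ + n.smulRight (P₂ v) + n v • n.smulRight W₂)) → (∀ v, fderiv ℝ (fderiv ℝ G₃) x v = fderiv ℝ (fderiv ℝ G) x v + (n v • (c₁ • P₁ + c₂ • P₂) + n.smulRight ((c₁ • P₁ + c₂ • P₂) v) + n v • n.smulRight W₃)) → ∀ e : E4, n e = 0 → MetricCoord.ricAt G₃ x (MetricCoord.sharpAt G x n) e - MetricCoord.ricAt G x (MetricCoord.sharpAt G x n) e = c₁ * (MetricCoord.ricAt G₁ x (MetricCoord.sharpAt G x n) e - MetricCoord.ricAt G x (MetricCoord.sharpAt G x n) e) + c₂ * (MetricCoord.ricAt G₂ x (MetricCoord.sharpAt G x n) e - MetricCoord.ricAt G x (MetricCoord.sharpAt G x n) e))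
    (M a : ℝ) {Y : Submodule ℝ ((E4 →L[ℝ] E4) × E4)}
    (hdec : ∀ (A : E4 →L[ℝ] E4) (d : E4),
      (∀ u w : E4, Minkowski.bilin (A u) w + Minkowski.bilin u (A w) = 0) →
      ∃ (K : E4 →L[ℝ] E4) (k : E4),
        (∀ u w : E4, Minkowski.bilin (K u) w + Minkowski.bilin u (K w) = 0) ∧
        K (E4.basisVector 0) = 0 ∧ (a ≠ 0 → K (E4.basisVector 3) = 0) ∧ E4.spatial k = 0 ∧
        ((A - K, d - k) : (E4 →L[ℝ] E4) × E4) ∈ Y)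
    {G : E4 → E4 →L[ℝ] E4 →L[ℝ] ℝ} {V : Set E4} (hG : IsMetricOn G V) (S : E4 →L[ℝ] E4)
    {A : E4 →L[ℝ] E4} (hA : ∀ u w : E4, Minkowski.bilin (A u) w + Minkowski.bilin u (A w) = 0)
    (d : E4) {ρ₁ ρ₂ ε : ℝ} (hne : ∃ y : E3, ρ₁ ≤ ‖y‖ ∧ ‖y‖ ≤ ρ₂)
    (hV : ∀ y : E3, ρ₁ ≤ ‖y‖ → ‖y‖ ≤ ρ₂ →
      E4.ofTimeSpace 0 y ∈ V ∧ 0 < Kerr.radius a (S (E4.ofTimeSpace 0 y)))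
    (hbad : ∀ y : E3, ρ₁ ≤ ‖y‖ → ‖y‖ ≤ ρ₂ →
      ∑ j : Fin 3, |(ricAt (fun z : E4 ↦ G z + (z 0) • ((fderiv ℝ (Kerr.bilin M a) (S z) (A (S z) + d)).bilinearComp S S + (Kerr.bilin M a (S z)).bilinearComp (A.comp S) S + (Kerr.bilin M a (S z)).bilinearComp S (A.comp S))) (E4.ofTimeSpace 0 y) (sharpAt G (E4.ofTimeSpace 0 y) (E4.dx 0)) (E4.basisVector j.succ) - ricAt G (E4.ofTimeSpace 0 y) (sharpAt G (E4.ofTimeSpace 0 y) (E4.dx 0)) (E4.basisVector j.succ))| < ε * (‖A (E4.basisVector 0)‖ + ‖E4.spatial d‖ + ‖a • A (E4.basisVector 3)‖)) :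
    ∃ p ∈ Y, ‖p‖ = 1 ∧ ∀ y : E3, ρ₁ ≤ ‖y‖ → ‖y‖ ≤ ρ₂ →
      ∑ j : Fin 3, |(ricAt (fun z : E4 ↦ G z + (z 0) • ((fderiv ℝ (Kerr.bilin M a) (S z) (p.1 (S z) + p.2)).bilinearComp S S + (Kerr.bilin M a (S z)).bilinearComp (p.1.comp S) S + (Kerr.bilin M a (S z)).bilinearComp S (p.1.comp S))) (E4.ofTimeSpace 0 y) (sharpAt G (E4.ofTimeSpace 0 y) (E4.dx 0)) (E4.basisVector j.succ) - ricAt G (E4.ofTimeSpace 0 y) (sharpAt G (E4.ofTimeSpace 0 y) (E4.dx 0)) (E4.basisVector j.succ))| < ε * (1 + |a| + ‖E4.spatial‖) := by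
  -- remove the stabiliser part
  obtain ⟨K, k, hK, hK0, hK3, hk, hY⟩ := hdec A d hA
  obtain ⟨B, hB⟩ : ∃ B : E4 →L[ℝ] E4, B = A - K := ⟨_, rfl⟩
  obtain ⟨c, hc⟩ : ∃ c : E4, c = d - k := ⟨_, rfl⟩
  have hAB : A = B + K := by rw [hB, sub_add_cancel]
  have hdc : d = c + k := by rw [hc, sub_add_cancel]
  have hY' : ((B, c) : (E4 →L[ℝ] E4) × E4) ∈ Y := by rw [hB, hc]; exact hY
  have haK : a • K (E4.basisVector 3) = 0 := by
    by_cases ha : a = 0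
    · rw [ha, zero_smul]
    · rw [hK3 ha, smul_zero]
  have hred : ‖A (E4.basisVector 0)‖ + ‖E4.spatial d‖ + ‖a • A (E4.basisVector 3)‖
      = ‖B (E4.basisVector 0)‖ + ‖E4.spatial c‖ + ‖a • B (E4.basisVector 3)‖ := by
    rw [hAB, hdc, _root_.add_apply, hK0, add_zero, map_add, hk, add_zero,
      _root_.add_apply, smul_add, haK, add_zero]
  have hrows : ∀ y : E3, ρ₁ ≤ ‖y‖ → ‖y‖ ≤ ρ₂ →
      ricAt (fun z : E4 ↦ G z + (z 0) • ((fderiv ℝ (Kerr.bilin M a) (S z) (A (S z) + d)).bilinearComp S S + (Kerr.bilin M a (S z)).bilinearComp (A.comp S) S + (Kerr.bilin M a (S z)).bilinearComp S (A.comp S))) (E4.ofTimeSpace 0 y)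
        = ricAt (fun z : E4 ↦ G z + (z 0) • ((fderiv ℝ (Kerr.bilin M a) (S z) (B (S z) + c)).bilinearComp S S + (Kerr.bilin M a (S z)).bilinearComp (B.comp S) S + (Kerr.bilin M a (S z)).bilinearComp S (B.comp S))) (E4.ofTimeSpace 0 y) := by
    intro y h1 h2
    rw [hAB, hdc]
    exact coerMomQ_ricAt_add_stab G M a S B c hK hK0 hK3 hk (hV y h1 h2).2
  -- the failing inequality for the stabiliser-free motion `(B, c)`
  have hbad' : ∀ y : E3, ρ₁ ≤ ‖y‖ → ‖y‖ ≤ ρ₂ →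
      ∑ j : Fin 3, |(ricAt (fun z : E4 ↦ G z + (z 0) • ((fderiv ℝ (Kerr.bilin M a) (S z) (B (S z) + c)).bilinearComp S S + (Kerr.bilin M a (S z)).bilinearComp (B.comp S) S + (Kerr.bilin M a (S z)).bilinearComp S (B.comp S))) (E4.ofTimeSpace 0 y) (sharpAt G (E4.ofTimeSpace 0 y) (E4.dx 0)) (E4.basisVector j.succ) - ricAt G (E4.ofTimeSpace 0 y) (sharpAt G (E4.ofTimeSpace 0 y) (E4.dx 0)) (E4.basisVector j.succ))| < ε * (‖B (E4.basisVector 0)‖ + ‖E4.spatial c‖ + ‖a • B (E4.basisVector 3)‖) := by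
    intro y h1 h2
    have h := hbad y h1 h2
    rw [hred, hrows y h1 h2] at h
    exact h
  -- `(B, c) ≠ 0`
  obtain ⟨y₀, hy₀₁, hy₀₂⟩ := hne
  have hpos : 0 < ‖B (E4.basisVector 0)‖ + ‖E4.spatial c‖ + ‖a • B (E4.basisVector 3)‖ := by
    have h := hbad' y₀ hy₀₁ hy₀₂
    have hs : 0 ≤ ∑ j : Fin 3, |(ricAt (fun z : E4 ↦ G z + (z 0) • ((fderiv ℝ (Kerr.bilin M a) (S z) (B (S z) + c)).bilinearComp S S + (Kerr.bilin M a (S z)).bilinearComp (B.comp S) S + (Kerr.bilin M a (S z)).bilinearComp S (B.comp S))) (E4.ofTimeSpace 0 y₀) (sharpAt G (E4.ofTimeSpace 0 y₀) (E4.dx 0)) (E4.basisVector j.succ) - ricAt G (E4.ofTimeSpace 0 y₀) (sharpAt G (E4.ofTimeSpace 0 y₀) (E4.dx 0)) (E4.basisVector j.succ))| := Finset.sum_nonneg fun j _ ↦ abs_nonneg _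
    have hεr : 0 < ε * (‖B (E4.basisVector 0)‖ + ‖E4.spatial c‖ + ‖a • B (E4.basisVector 3)‖) :=
      hs.trans_lt h
    rcases (lt_trichotomy 0 (‖B (E4.basisVector 0)‖ + ‖E4.spatial c‖
      + ‖a • B (E4.basisVector 3)‖)) with hlt | heq | hgt
    · exact hlt
    · rw [← heq, mul_zero] at hεr; exact absurd hεr (lt_irrefl 0)
    · exact absurd hgt (not_lt.mpr (by positivity))
  have hp0 : ((B, c) : (E4 →L[ℝ] E4) × E4) ≠ 0 := by
    intro h0
    have hB0 : B = 0 := congrArg Prod.fst h0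
    have hc0 : c = 0 := congrArg Prod.snd h0
    rw [hB0, hc0] at hpos
    simp at hpos
  set t : ℝ := ‖((B, c) : (E4 →L[ℝ] E4) × E4)‖ with ht
  have htpos : 0 < t := norm_pos_iff.mpr hp0
  have htinv : 0 < t⁻¹ := inv_pos.mpr htpos
  -- the normalised motion
  refine ⟨t⁻¹ • (B, c), Y.smul_mem _ hY', ?_, fun y h1 h2 ↦ ?_⟩
  · rw [norm_smul, Real.norm_eq_abs, abs_of_pos htinv, ← ht, inv_mul_cancel₀ htpos.ne']
  · simp only [Prod.smul_mk]
    have hxV := (hV y h1 h2).1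
    have hr := (hV y h1 h2).2
    have hx0 : (E4.ofTimeSpace 0 y) 0 = 0 := by simp
    have hhom : ∀ j : Fin 3, (ricAt (fun z : E4 ↦ G z + (z 0) • ((fderiv ℝ (Kerr.bilin M a) (S z) ((t⁻¹ • B) (S z) + t⁻¹ • c)).bilinearComp S S + (Kerr.bilin M a (S z)).bilinearComp ((t⁻¹ • B).comp S) S + (Kerr.bilin M a (S z)).bilinearComp S ((t⁻¹ • B).comp S))) (E4.ofTimeSpace 0 y) (sharpAt G (E4.ofTimeSpace 0 y) (E4.dx 0)) (E4.basisVector j.succ) - ricAt G (E4.ofTimeSpace 0 y) (sharpAt G (E4.ofTimeSpace 0 y) (E4.dx 0)) (E4.basisVector j.succ)) = t⁻¹ * (ricAt (fun z : E4 ↦ G z + (z 0) • ((fderiv ℝ (Kerr.bilin M a) (S z) (B (S z) + c)).bilinearComp S S + (Kerr.bilin M a (S z)).bilinearComp (B.comp S) S + (Kerr.bilin M a (S z)).bilinearComp S (B.comp S))) (E4.ofTimeSpace 0 y) (sharpAt G (E4.ofTimeSpace 0 y) (E4.dx 0)) (E4.basisVector j.succ) - ricAt G (E4.ofTimeSpace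 0 y) (sharpAt G (E4.ofTimeSpace 0 y) (E4.dx 0)) (E4.basisVector j.succ)) :=
      fun j ↦ coerMomQ_row_smul hML hG hxV hx0 M a S B c hr t⁻¹ (E4.basisVector j.succ)
        (coerMomQ_dx_zero_basisVector_succ j)
    simp only [hhom, abs_mul, abs_of_pos htinv, ← Finset.mul_sum]
    have hb := hbad' y h1 h2
    -- the reduced size of the normalised motion is at most `1 + |a| + ‖spatial‖`
    have hn1 : ‖t⁻¹ • B‖ ≤ 1 := by
      have h := norm_fst_le (t⁻¹ • ((B, c) : (E4 →L[ℝ] E4) × E4))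
      rw [norm_smul, Real.norm_eq_abs, abs_of_pos htinv, ← ht, inv_mul_cancel₀ htpos.ne'] at h
      simpa [norm_smul, abs_of_pos htinv] using h
    have hn2 : ‖t⁻¹ • c‖ ≤ 1 := by
      have h := norm_snd_le (t⁻¹ • ((B, c) : (E4 →L[ℝ] E4) × E4))
      rw [norm_smul, Real.norm_eq_abs, abs_of_pos htinv, ← ht, inv_mul_cancel₀ htpos.ne'] at h
      simpa [norm_smul, abs_of_pos htinv] using h
    have he0 : ‖(E4.basisVector 0 : E4)‖ = 1 := by
      rw [E4.basisVector, PiLp.norm_single, norm_one]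
    have he3 : ‖(E4.basisVector 3 : E4)‖ = 1 := by
      rw [E4.basisVector, PiLp.norm_single, norm_one]
    have hred' : t⁻¹ * (‖B (E4.basisVector 0)‖ + ‖E4.spatial c‖ + ‖a • B (E4.basisVector 3)‖)
        ≤ 1 + |a| + ‖E4.spatial‖ := by
      have h1' : ‖(t⁻¹ • B) (E4.basisVector 0)‖ ≤ 1 := by
        calc ‖(t⁻¹ • B) (E4.basisVector 0)‖ ≤ ‖t⁻¹ • B‖ * ‖(E4.basisVector 0 : E4)‖ :=
              ContinuousLinearMap.le_opNorm _ _
          _ ≤ 1 * 1 := by rw [he0]; exact mul_le_mul_of_nonneg_right hn1 zero_le_one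
          _ = 1 := one_mul 1
      have h2' : ‖E4.spatial (t⁻¹ • c)‖ ≤ ‖E4.spatial‖ := by
        calc ‖E4.spatial (t⁻¹ • c)‖ ≤ ‖E4.spatial‖ * ‖t⁻¹ • c‖ := ContinuousLinearMap.le_opNorm _ _
          _ ≤ ‖E4.spatial‖ * 1 := mul_le_mul_of_nonneg_left hn2 (norm_nonneg _)
          _ = ‖E4.spatial‖ := mul_one _
      have h3' : ‖a • (t⁻¹ • B) (E4.basisVector 3)‖ ≤ |a| := by
        rw [norm_smul, Real.norm_eq_abs]
        calc |a| * ‖(t⁻¹ • B) (E4.basisVector 3)‖ ≤ |a| * (‖t⁻¹ • B‖ * ‖(E4.basisVector 3 : E4)‖) :=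
              mul_le_mul_of_nonneg_left (ContinuousLinearMap.le_opNorm _ _) (abs_nonneg a)
          _ ≤ |a| * (1 * 1) := by
              rw [he3]
              exact mul_le_mul_of_nonneg_left (mul_le_mul_of_nonneg_right hn1 zero_le_one)
                (abs_nonneg a)
          _ = |a| := by ring
      have heq : t⁻¹ * (‖B (E4.basisVector 0)‖ + ‖E4.spatial c‖ + ‖a • B (E4.basisVector 3)‖)
          = ‖(t⁻¹ • B) (E4.basisVector 0)‖ + ‖E4.spatial (t⁻¹ • c)‖
            + ‖a • (t⁻¹ • B) (E4.basisVector 3)‖ := by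
        have e1 : (t⁻¹ • B) (E4.basisVector 0) = t⁻¹ • B (E4.basisVector 0) := rfl
        have e2 : E4.spatial (t⁻¹ • c) = t⁻¹ • E4.spatial c := map_smul _ _ _
        have e3 : a • (t⁻¹ • B) (E4.basisVector 3) = t⁻¹ • (a • B (E4.basisVector 3)) := by
          rw [_root_.smul_apply]; exact smul_comm _ _ _
        rw [e1, e2, e3]
        simp only [norm_smul, Real.norm_eq_abs, abs_of_pos htinv]
        ring
      rw [heq]
      linarith
    have hε : 0 ≤ ε := by
      by_contra hε
      push Not at hε
      have hs : 0 ≤ ∑ j : Fin 3, |(ricAt (fun z : E4 ↦ G z + (z 0) • ((fderiv ℝ (Kerr.bilin M a) (S z) (B (S z) + c)).bilinearComp S S + (Kerr.bilin M a (S z)).bilinearComp (B.comp S) S + (Kerr.bilin M a (S z)).bilinearComp S (B.comp S))) (E4.ofTimeSpace 0 y) (sharpAt G (E4.ofTimeSpace 0 y) (E4.dx 0)) (E4.basisVector j.succ) - ricAt G (E4.ofTimeSpace 0 y) (sharpAt G (E4.ofTimeSpace 0 y) (E4.dx 0)) (E4.basisVector j.succ))| := Finset.sum_nonneg fun j _ ↦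 abs_nonneg _
      have := hs.trans_lt hb
      nlinarith [hpos.le]
    calc t⁻¹ * ∑ j : Fin 3, |(ricAt (fun z : E4 ↦ G z + (z 0) • ((fderiv ℝ (Kerr.bilin M a) (S z) (B (S z) + c)).bilinearComp S S + (Kerr.bilin M a (S z)).bilinearComp (B.comp S) S + (Kerr.bilin M a (S z)).bilinearComp S (B.comp S))) (E4.ofTimeSpace 0 y) (sharpAt G (E4.ofTimeSpace 0 y) (E4.dx 0)) (E4.basisVector j.succ) - ricAt G (E4.ofTimeSpace 0 y) (sharpAt G (E4.ofTimeSpace 0 y) (E4.dx 0)) (E4.basisVector j.succ))|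
        < t⁻¹ * (ε * (‖B (E4.basisVector 0)‖ + ‖E4.spatial c‖ + ‖a • B (E4.basisVector 3)‖)) :=
          mul_lt_mul_of_pos_left hb htinv
      _ = ε * (t⁻¹ * (‖B (E4.basisVector 0)‖ + ‖E4.spatial c‖ + ‖a • B (E4.basisVector 3)‖)) := by
          ring
      _ ≤ ε * (1 + |a| + ‖E4.spatial‖) := mul_le_mul_of_nonneg_left hred' hε

/-! ### Vanishing of limit rows -/

/-- **Rows that are eventually small along a convergent sequence have a vanishing limit row**
(`coerMomQ_tendsto_row` and uniqueness of limits). [folklore] -/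
theorem coerMomQ_limit_row_eq_zero (M a : ℝ) {S A : ℕ → E4 →L[ℝ] E4} {d : ℕ → E4}
    {G : ℕ → E4 → E4 →L[ℝ] E4 →L[ℝ] ℝ} {V : ℕ → Set E4} {S₀ A₀ : E4 →L[ℝ] E4} {d₀ : E4}
    {U₀ : Set E4} {x : E4} (hx0 : x 0 = 0)
    (hS : Tendsto S atTop (𝓝 S₀)) (hA : Tendsto A atTop (𝓝 A₀)) (hd : Tendsto d atTop (𝓝 d₀))
    (hr : 0 < Kerr.radius a (S₀ x))
    (hK₀ : IsMetricOn (fun z : E4 ↦ (Kerr.bilin M a (S₀ z)).bilinearComp S₀ S₀) U₀) (hxU₀ : x ∈ U₀)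
    (hGV : ∀ᶠ n in atTop, IsMetricOn (G n) (V n) ∧ x ∈ V n)
    (h0 : Tendsto (fun n ↦ G n x - (Kerr.bilin M a (S n x)).bilinearComp (S n) (S n)) atTop (𝓝 0))
    (h1 : Tendsto (fun n ↦ fderiv ℝ (G n) x - fderiv ℝ (fun z : E4 ↦ (Kerr.bilin M a ((S n) z)).bilinearComp (S n) (S n)) x) atTop (𝓝 0))
    (h2 : Tendsto (fun n ↦ fderiv ℝ (fderiv ℝ (G n)) x - fderiv ℝ (fderiv ℝ (fun z : E4 ↦ (Kerr.bilin M a ((S n) z)).bilinearComp (S n) (S n))) x)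
      atTop (𝓝 0))
    (e : E4) {ε : ℕ → ℝ} (hε : Tendsto ε atTop (𝓝 0))
    (hsmall : ∀ᶠ n in atTop, |(ricAt (fun z : E4 ↦ (G n) z + (z 0) • ((fderiv ℝ (Kerr.bilin M a) ((S n) z) ((A n) ((S n) z) + (d n))).bilinearComp (S n) (S n) + (Kerr.bilin M a ((S n) z)).bilinearComp ((A n).comp (S n)) (S n) + (Kerr.bilin M a ((S n) z)).bilinearComp (S n) ((A n).comp (S n)))) x (sharpAt (G n) x (E4.dx 0)) e - ricAt (G n) x (sharpAt (G n) x (E4.dx 0)) e)| ≤ ε n) :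
    (ricAt (fun z : E4 ↦ (fun z : E4 ↦ (Kerr.bilin M a (S₀ z)).bilinearComp S₀ S₀) z + (z 0) • ((fderiv ℝ (Kerr.bilin M a) (S₀ z) (A₀ (S₀ z) + d₀)).bilinearComp S₀ S₀ + (Kerr.bilin M a (S₀ z)).bilinearComp (A₀.comp S₀) S₀ + (Kerr.bilin M a (S₀ z)).bilinearComp S₀ (A₀.comp S₀))) x (sharpAt (fun z : E4 ↦ (Kerr.bilin M a (S₀ z)).bilinearComp S₀ S₀) x (E4.dx 0)) e - ricAt (fun z : E4 ↦ (Kerr.bilin M a (S₀ z)).bilinearComp S₀ S₀) x (sharpAt (fun z : E4 ↦ (Kerr.bilin M a (S₀ z)).bilinearComp S₀ S₀) x (E4.dx 0)) e) = 0 := by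
  have hT := coerMomQ_tendsto_row M a hx0 hS hA hd hr hK₀ hxU₀ hGV h0 h1 h2 e
  have hT' := hT.abs
  have hZ : Tendsto (fun n ↦ |(ricAt (fun z : E4 ↦ (G n) z + (z 0) • ((fderiv ℝ (Kerr.bilin M a) ((S n) z) ((A n) ((S n) z) + (d n))).bilinearComp (S n) (S n) + (Kerr.bilin M a ((S n) z)).bilinearComp ((A n).comp (S n)) (S n) + (Kerr.bilin M a ((S n) z)).bilinearComp (S n) ((A n).comp (S n)))) x (sharpAt (G n) x (E4.dx 0)) e - ricAt (G n) x (sharpAt (G n) x (E4.dx 0)) e)|) atTop (𝓝 0) :=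
    squeeze_zero' (Eventually.of_forall fun n ↦ abs_nonneg _) hsmall hε
  exact abs_eq_zero.mp (tendsto_nhds_unique hT' hZ)

/-- **Registered one-line carrier form** (`coerMomQ_boostedKerrBilin_frame_bs`) of
`coerMomQ_boostedKerrBilin_eq_frame`. [cite: KerrSchild1965, §3] -/
theorem coerMomQ_boostedKerrBilin_frame_bs : open Literature.Geometry.Lorentzian in ∀ (L : lorentzGroup) (M a : ℝ), boostedKerrBilin L 0 M a = fun z : E4 ↦ (Kerr.bilin M a (((L : E4 ≃L[ℝ] E4).symm : E4 →L[ℝ] E4) z)).bilinearComp ((L : E4 ≃L[ℝ] E4).symm : E4 →L[ℝ] E4) ((L : E4 ≃L[ℝ] E4).symm : E4 →L[ℝ] E4) :=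
  fun L M a ↦ coerMomQ_boostedKerrBilin_eq_frame L M a

end Summit.FinalStateConjecture.FinalStateConjecture.Theorems.SublinearIsFree.Slaving

end
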